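/-
Copyright (c) 2026. All rights reserved.
Released under Apache 2.0 license as described in the file LICENSE.
-/
import Literature.AlgebraicGeometry.ComplexMultiplication.HyperellipticJacobianEightTimesPrimeLevel
import HarnessLib

/-!
# GGL 2024 Thm. 3.0 + Lemma 14 at `m = 40` (the level `8p` containing the exceptional divisor `20`):
# `J_{40} ∼ X_4 × Y_8² × X_5² × Y_{20}⁴ × Y_{40}²` and
# `End⁰(J_{40}) ≅ ℚ(i) × Mat₂(ℚ(√−2)) × Mat₂(ℚ(ζ_5)) × Mat₄(ℚ(√−5)) × Mat₂(ℚ(ζ_{40} − ζ_{40}⁻¹))`, of dimension `90`, `dim J_{40} = 19`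

Layer `Literature/AlgebraicGeometry/ComplexMultiplication`, namespace `…ComplexMultiplication.HyperellipticJacobian`; the `p = 5` companion of
`HyperellipticJacobianEightTimesPrimeLevel` (F21: `J_{8p}`, `p ≥ 7`), where the divisor `4p = 20` is exceptional (`X_{20} ∼ Y_{20}⁴`, CM field
`ℚ(√−5)`, F9 ∕ F16).  THEOREMS ONLY (no definition, no named fact, no `sorry`, no instance).

## The print

A. Gallese, H. Goodson, D. Lombardo, arXiv:2405.20394 [GalleseGoodsonLombardo2024] (held `paper:arxiv-2405.20394`, p0012, p0014, p0015 read first-hand):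
THM. 3.0 and §3.5 LEMMA 14 with the sentence following it.  For `m = 40` the divisors `d ∉ {1, 2}` are `4, 5, 8, 10, 20, 40`: `X_{10} ∼ X_5` (4),
`X_8 ∼ Y_8²`, `X_{40} ∼ Y_{40}²` (5), `X_{20} ∼ Y_{20}⁴` (6); the five blocks are pairwise orthogonal — `X_4 ⟂ Y_8, Y_{40}` (`8 ∣ d`), `X_4 ⟂ Y_{20}`
(F16), `X_5, X_{10} ⟂ X_4, Y_8` (fifth roots of unity, `5 ∤ 4, 8`), `X_5, X_{10} ⟂ Y_{20}, Y_{40}` (F12), `Y_8 ⟂ Y_{20}` (F17: `ℚ(√−2) ≠ ℚ(√−5)`),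
`Y_8 ⟂ Y_{40}` (degrees `2 ≠ 8`), `Y_{20} ⟂ Y_{40}` (degrees `2 ≠ 8`, this file) — so
`End⁰(J_{40}) ≅ ℚ(i) × Mat₂(ℚ(ζ_8 − ζ_8⁻¹)) × Mat₂(ℚ(ζ_5)) × Mat₄(ℚ(√−5)) × Mat₂(ℚ(ζ_{40} − ζ_{40}⁻¹))`, of dimension `2 + 8 + 16 + 32 + 32 = 90`;
`dim J_{40} = 1 + 2 + 4 + 4 + 8 = 19 = g(C_{40})`.

## What is proved

`orthogonal_twenty_fourDvd_of_totient_ne_four` (`Y_{20} ⟂ Y_d` for `4 ∣ d ≥ 8` non-exceptional with `φ(d) ≠ 4`), **`hom_eq_zero_blocks_forty`**,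
**`nonempty_endAlgebra_algEquiv_fortyJacobian`** (`End⁰(J) ≃ₐ[ℚ] K₄ × (Mat₂(ℚ(ζ_8 − ζ_8⁻¹)) × (Mat₂(K₅) × (Mat₄(ℚ(r₂₀)) × Mat₂(ℚ(ζ_{40} − ζ_{40}⁻¹)))))`,
`r₂₀² = −5`), **`finrank_endAlgebra_fortyJacobian`** (`dim_ℚ = 90`, `dim J = 19`).

## Honest column ∕ NOT here

The curve; `J_{120}` etc.; `Y_d` vs `Y_{d′}` with `φ(d) = φ(d′)`, `d ≡ d′ (mod 8)`.  `HC_CM` is not touched.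

## References

* [GalleseGoodsonLombardo2024] arXiv:2405.20394 — §3 Thm. 3.0 ((4)–(6), last statement), §3.4, §3.5 Lemma 14 and the sentence following it.
* [MumfordAV1970] D. Mumford — §19 Thm. 3 Cor. 1–2, p. 174.
* [Shimura1998] G. Shimura — §5.1 Prop. 3, Prop. 6, §8.3 Prop. 28.
* [MilneCM2006] J. S. Milne — Ch. I §1 Prop. 1.18 (c), §3 Prop. 3.13.

## Provenance

Cell `pub-hodgecm2` (COR-CM), KEPT Literature lane `lit-deligne-3` gen 52 (claim GGL24-LEVEL-FORTY; count-neutral, own lane).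
-/

noncomputable section

open CategoryTheory CategoryTheory.Limits NumberField Module

namespace Literature.AlgebraicGeometry.ComplexMultiplication

open Literature.AlgebraicGeometry.Motives
open Literature.AlgebraicGeometry.HodgeTheory (complexBetti)
open Literature.NumberTheory.ComplexMultiplication

namespace HyperellipticJacobian

open Literature.AlgebraicGeometry.Pohlmann1968 Literature.AlgebraicGeometry.Pohlmann1968.Cyclotomic

/-! ## §1 `Y_{20}` against `Y_d` of reflex degree `≠ 2` -/

section Twenty

variable {K : Type} [Field K] [NumberField K] [IsCyclotomicExtension {20} ℚ K] {Φ : CMType K}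
  {A : AbelianVariety ℂ} {ι : 𝓞 K →+* End A} {θ : K →+* Module.End ℂ (complexBetti A.X 1)}
  {d : ℕ} [NeZero d] {Kd : Type} [Field Kd] [NumberField Kd] [IsCyclotomicExtension {d} ℚ Kd] {Φd : CMType Kd}
  {Ad : AbelianVariety ℂ} {ιd : 𝓞 Kd →+* End Ad} {θd : Kd →+* Module.End ℂ (complexBetti Ad.X 1)}

/-- **`Y_{20} ⟂ Y_d` for `4 ∣ d ≥ 8`, `d ∉ {20, 24, 60}` with `φ(d) ≠ 4`** — e.g. `Y_{20} ⟂ Y_{40}` (reflex degrees `[ℚ(√−5) : ℚ] = 2 ≠ φ(d)/2`).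
[cite: GalleseGoodsonLombardo2024, §3 Thm. 3.0 (last statement) and §3.4] [cite: MilneCM2006, Ch. I §1 Prop. 1.18 (c) and §3 Prop. 3.13] -/
theorem orthogonal_twenty_fourDvd_of_totient_ne_four (hΦ : ∀ σ : K →+* ℂ, σ ∈ Φ.1 ↔ 2 * (expOf 20 K σ).val < 20)
    (hA : IsCMTypeRealisation Φ A ι θ) (h4 : 4 ∣ d) (h8 : 8 ≤ d) (h20 : d ≠ 20) (h24 : d ≠ 24) (h60 : d ≠ 60)
    (hφ : Nat.totient d ≠ 4) (hΦd : ∀ σ : Kd →+* ℂ, σ ∈ Φd.1 ↔ 2 * (expOf d Kd σ).val < d) (hAd : IsCMTypeRealisation Φd Ad ιd θd) :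
    (∀ u : A ⟶ Ad, u = 0) ∧ (∀ v : Ad ⟶ A, v = 0) ∧
      ¬ AbelianVariety.IsIsogenous A Ad ∧ ¬ AbelianVariety.IsIsogenous Ad A := by
  obtain ⟨x⟩ := (inferInstance : Nonempty (K →+* ℂ))
  obtain ⟨-, -, h2, -⟩ := traceField_twenty Φ hΦ x
  refine hA.orthogonal_of_finrank_traceField_ne hAd fun h => hφ ?_
  rw [← two_mul_finrank_traceField_of_four_dvd h4 h8 h20 h24 h60 Φd hΦd, ← h, h2]

end Twenty

/-! ## §2 The five blocks of `J_{40}` are pairwise orthogonal -/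

section Forty

variable {K₄ : Type} [Field K₄] [NumberField K₄] [IsCyclotomicExtension {4} ℚ K₄] {Φ₄ : CMType K₄}
  {A₄ : AbelianVariety ℂ} {ι₄ : 𝓞 K₄ →+* End A₄} {θ₄ : K₄ →+* Module.End ℂ (complexBetti A₄.X 1)}
  {K₈ : Type} [Field K₈] [NumberField K₈] [IsCyclotomicExtension {8} ℚ K₈] {Φ₈ : CMType K₈}
  {A₈ : AbelianVariety ℂ} {ι₈ : 𝓞 K₈ →+* End A₈} {θ₈ : K₈ →+* Module.End ℂ (complexBetti A₈.X 1)}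
  {K₅ : Type} [Field K₅] [NumberField K₅] [IsCyclotomicExtension {5} ℚ K₅] {Φ₅ : CMType K₅}
  {A₅ : AbelianVariety ℂ} {ι₅ : 𝓞 K₅ →+* End A₅} {θ₅ : K₅ →+* Module.End ℂ (complexBetti A₅.X 1)}
  {L₅ : Type} [Field L₅] [NumberField L₅] [IsCyclotomicExtension {2 * 5} ℚ L₅] {Ψ₅ : CMType L₅}
  {A₁₀ : AbelianVariety ℂ} {ι₁₀ : 𝓞 L₅ →+* End A₁₀} {θ₁₀ : L₅ →+* Module.End ℂ (complexBetti A₁₀.X 1)}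
  {K₂₀ : Type} [Field K₂₀] [NumberField K₂₀] [IsCyclotomicExtension {20} ℚ K₂₀] {Φ₂₀ : CMType K₂₀}
  {A₂₀ : AbelianVariety ℂ} {ι₂₀ : 𝓞 K₂₀ →+* End A₂₀} {θ₂₀ : K₂₀ →+* Module.End ℂ (complexBetti A₂₀.X 1)}
  {K₄₀ : Type} [Field K₄₀] [NumberField K₄₀] [IsCyclotomicExtension {40} ℚ K₄₀] {Φ₄₀ : CMType K₄₀}
  {A₄₀ : AbelianVariety ℂ} {ι₄₀ : 𝓞 K₄₀ →+* End A₄₀} {θ₄₀ : K₄₀ →+* Module.End ℂ (complexBetti A₄₀.X 1)}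

/-- **The blocks `X_4`, `X_8`, `X_5 ⊕ X_{10}`, `X_{20}`, `X_{40}` of `J_{40}` are pairwise orthogonal** (the ten relations of the module
docstring, F12 ∕ F16 ∕ F17 ∕ F20 ∕ F21 ∕ §1, assembled with `hom_eq_zero_vecCons`).
[cite: GalleseGoodsonLombardo2024, §3 Thm. 3.0 (last statement) and §3.4] [cite: MilneCM2006, Ch. I §3 Prop. 3.13] -/
theorem hom_eq_zero_blocks_forty (hA₄ : IsCMTypeRealisation Φ₄ A₄ ι₄ θ₄)
    (hΦ₈ : ∀ σ : K₈ →+* ℂ, σ ∈ Φ₈.1 ↔ 2 * (expOf 8 K₈ σ).val < 8) (hA₈ : IsCMTypeRealisation Φ₈ A₈ ι₈ θ₈)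
    (hΦ₅ : ∀ σ : K₅ →+* ℂ, σ ∈ Φ₅.1 ↔ 2 * (expOf 5 K₅ σ).val < 5) (hA₅ : IsCMTypeRealisation Φ₅ A₅ ι₅ θ₅)
    (hΨ₅ : ∀ σ : L₅ →+* ℂ, σ ∈ Ψ₅.1 ↔ 2 * (expOf (2 * 5) L₅ σ).val < 2 * 5) (hA₁₀ : IsCMTypeRealisation Ψ₅ A₁₀ ι₁₀ θ₁₀)
    (hΦ₂₀ : ∀ σ : K₂₀ →+* ℂ, σ ∈ Φ₂₀.1 ↔ 2 * (expOf 20 K₂₀ σ).val < 20) (hA₂₀ : IsCMTypeRealisation Φ₂₀ A₂₀ ι₂₀ θ₂₀)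
    (hΦ₄₀ : ∀ σ : K₄₀ →+* ℂ, σ ∈ Φ₄₀.1 ↔ 2 * (expOf 40 K₄₀ σ).val < 40) (hA₄₀ : IsCMTypeRealisation Φ₄₀ A₄₀ ι₄₀ θ₄₀) :
    ∀ i j : Fin 5, i ≠ j →
      ∀ f : (![A₄, A₈, ⨁ fun l : Fin 2 => (![A₅, A₁₀] : Fin 2 → AbelianVariety ℂ) l, A₂₀, A₄₀] : Fin 5 → AbelianVariety ℂ) i ⟶
        (![A₄, A₈, ⨁ fun l : Fin 2 => (![A₅, A₁₀] : Fin 2 → AbelianVariety ℂ) l, A₂₀, A₄₀] : Fin 5 → AbelianVariety ℂ) j, f = 0 := by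
  haveI : NeZero (2 * 5 : ℕ) := ⟨by norm_num⟩
  have hodd5 : Odd 5 := by decide
  have h35 : 3 ≤ 5 := by norm_num
  have h4 : 4 ∣ 40 := ⟨10, rfl⟩
  -- the ten relations
  have o48 := orthogonal_four_fourDvd_of_eight_dvd hA₄ (dvd_refl 8) (by norm_num) hΦ₈ hA₈
  have o5_4 := orthogonal_odd_of_not_dvd 4 hodd5 (by decide) hΦ₅ hA₅ hA₄
  have o10_4 := orthogonal_twiceOdd_of_not_dvd 4 hodd5 h35 (by decide) hΨ₅ hA₁₀ hA₄
  have o4_20 := orthogonal_four_twenty hA₄ hΦ₂₀ hA₂₀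
  have o4_40 := orthogonal_four_fourDvd_of_eight_dvd hA₄ (show 8 ∣ 40 from ⟨5, rfl⟩) (by norm_num) hΦ₄₀ hA₄₀
  have o5_8 := orthogonal_odd_of_not_dvd 8 hodd5 (by decide) hΦ₅ hA₅ hA₈
  have o10_8 := orthogonal_twiceOdd_of_not_dvd 8 hodd5 h35 (by decide) hΨ₅ hA₁₀ hA₈
  have o8_20 := orthogonal_eight_twenty hΦ₈ hA₈ hΦ₂₀ hA₂₀
  have o8_40 := orthogonal_eight_fourDvd_of_totient_ne_four hΦ₈ hA₈ h4 (by norm_num) (by norm_num) (by norm_num) (by norm_num)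
    (by decide +kernel) hΦ₄₀ hA₄₀
  have o5_20 := orthogonal_odd_twenty hodd5 h35 hΦ₅ hA₅ hΦ₂₀ hA₂₀
  have o10_20 := orthogonal_twiceOdd_twenty hodd5 h35 hΨ₅ hA₁₀ hΦ₂₀ hA₂₀
  have o5_40 := orthogonal_odd_fourDvd hodd5 h35 hΦ₅ hA₅ h4 (by norm_num) (by norm_num) (by norm_num) (by norm_num) hΦ₄₀ hA₄₀
  have o10_40 := orthogonal_twiceOdd_fourDvd hodd5 h35 hΨ₅ hA₁₀ h4 (by norm_num) (by norm_num) (by norm_num) (by norm_num) hΦ₄₀ hA₄₀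
  have o20_40 := orthogonal_twenty_fourDvd_of_totient_ne_four hΦ₂₀ hA₂₀ h4 (by norm_num) (by norm_num) (by norm_num) (by norm_num)
    (by decide +kernel) hΦ₄₀ hA₄₀
  -- block-level relations
  have b01 : (∀ u : A₄ ⟶ A₈, u = 0) ∧ (∀ v : A₈ ⟶ A₄, v = 0) := ⟨o48.1, o48.2.1⟩
  have b02 : (∀ u : A₄ ⟶ ⨁ fun l : Fin 2 => (![A₅, A₁₀] : Fin 2 → AbelianVariety ℂ) l, u = 0) ∧
      (∀ v : (⨁ fun l : Fin 2 => (![A₅, A₁₀] : Fin 2 → AbelianVariety ℂ) l) ⟶ A₄, v = 0) :=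
    ⟨fun u => hom_to_pair_eq_zero o5_4.2.1 o10_4.2.1 u, fun v => hom_from_pair_eq_zero o5_4.1 o10_4.1 v⟩
  have b03 : (∀ u : A₄ ⟶ A₂₀, u = 0) ∧ (∀ v : A₂₀ ⟶ A₄, v = 0) := ⟨o4_20.1, o4_20.2.1⟩
  have b04 : (∀ u : A₄ ⟶ A₄₀, u = 0) ∧ (∀ v : A₄₀ ⟶ A₄, v = 0) := ⟨o4_40.1, o4_40.2.1⟩
  have b12 : (∀ u : A₈ ⟶ ⨁ fun l : Fin 2 => (![A₅, A₁₀] : Fin 2 → AbelianVariety ℂ) l, u = 0) ∧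
      (∀ v : (⨁ fun l : Fin 2 => (![A₅, A₁₀] : Fin 2 → AbelianVariety ℂ) l) ⟶ A₈, v = 0) :=
    ⟨fun u => hom_to_pair_eq_zero o5_8.2.1 o10_8.2.1 u, fun v => hom_from_pair_eq_zero o5_8.1 o10_8.1 v⟩
  have b13 : (∀ u : A₈ ⟶ A₂₀, u = 0) ∧ (∀ v : A₂₀ ⟶ A₈, v = 0) := ⟨o8_20.1, o8_20.2.1⟩
  have b14 : (∀ u : A₈ ⟶ A₄₀, u = 0) ∧ (∀ v : A₄₀ ⟶ A₈, v = 0) := ⟨o8_40.1, o8_40.2.1⟩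
  have b23 : (∀ u : (⨁ fun l : Fin 2 => (![A₅, A₁₀] : Fin 2 → AbelianVariety ℂ) l) ⟶ A₂₀, u = 0) ∧
      (∀ v : A₂₀ ⟶ ⨁ fun l : Fin 2 => (![A₅, A₁₀] : Fin 2 → AbelianVariety ℂ) l, v = 0) :=
    ⟨fun u => hom_from_pair_eq_zero o5_20.1 o10_20.1 u, fun v => hom_to_pair_eq_zero o5_20.2.1 o10_20.2.1 v⟩
  have b24 : (∀ u : (⨁ fun l : Fin 2 => (![A₅, A₁₀] : Fin 2 → AbelianVariety ℂ) l) ⟶ A₄₀, u = 0) ∧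
      (∀ v : A₄₀ ⟶ ⨁ fun l : Fin 2 => (![A₅, A₁₀] : Fin 2 → AbelianVariety ℂ) l, v = 0) :=
    ⟨fun u => hom_from_pair_eq_zero o5_40.1 o10_40.1 u, fun v => hom_to_pair_eq_zero o5_40.2.1 o10_40.2.1 v⟩
  have b34 : (∀ u : A₂₀ ⟶ A₄₀, u = 0) ∧ (∀ v : A₄₀ ⟶ A₂₀, v = 0) := ⟨o20_40.1, o20_40.2.1⟩
  -- assemble by induction on the list of blocks (F20)
  have g3 := hom_eq_zero_vecCons (X := A₂₀) (F := (![A₄₀] : Fin 1 → AbelianVariety ℂ)) (Fin.cons b34 finZeroElim)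
    hom_eq_zero_of_fin_one
  have g2 := hom_eq_zero_vecCons (X := ⨁ fun l : Fin 2 => (![A₅, A₁₀] : Fin 2 → AbelianVariety ℂ) l)
    (F := (![A₂₀, A₄₀] : Fin 2 → AbelianVariety ℂ)) (Fin.cons b23 (Fin.cons b24 finZeroElim)) g3
  have g1 := hom_eq_zero_vecCons (X := A₈)
    (F := (![⨁ fun l : Fin 2 => (![A₅, A₁₀] : Fin 2 → AbelianVariety ℂ) l, A₂₀, A₄₀] : Fin 3 → AbelianVariety ℂ))
    (Fin.cons b12 (Fin.cons b13 (Fin.cons b14 finZeroElim))) g2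
  exact hom_eq_zero_vecCons (X := A₄)
    (F := (![A₈, ⨁ fun l : Fin 2 => (![A₅, A₁₀] : Fin 2 → AbelianVariety ℂ) l, A₂₀, A₄₀] : Fin 4 → AbelianVariety ℂ))
    (Fin.cons b01 (Fin.cons b02 (Fin.cons b03 (Fin.cons b04 finZeroElim)))) g1

/-! ## §3 `End⁰(J_{40}) ≅ ℚ(i) × Mat₂(ℚ(√−2)) × Mat₂(ℚ(ζ_5)) × Mat₄(ℚ(√−5)) × Mat₂(ℚ(ζ_{40} − ζ_{40}⁻¹))`, `dim_ℚ = 90`, `dim J_{40} = 19` -/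

omit [IsCyclotomicExtension {4} ℚ K₄] in
/-- `[ℚ(ζ_4) : ℚ] = 2`. [folklore] -/
private theorem finrank_eq_two_four_f [IsCyclotomicExtension {4} ℚ K₄] : finrank ℚ K₄ = 2 := by
  rw [finrank_eq_totient 4 K₄]
  decide +kernel

/-- The product of five algebras indexed by `Fin 5`. [folklore] -/
private theorem nonempty_pi_fin_five_algEquiv_prod' (T : Fin 5 → Type) [∀ i, Ring (T i)] [∀ i, Algebra ℚ (T i)] :
    Nonempty ((∀ i, T i) ≃ₐ[ℚ] T 0 × (T 1 × (T 2 × (T 3 × T 4)))) := by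
  refine ⟨AlgEquiv.ofBijective
    ((Pi.evalAlgHom ℚ T 0).prod ((Pi.evalAlgHom ℚ T 1).prod ((Pi.evalAlgHom ℚ T 2).prod ((Pi.evalAlgHom ℚ T 3).prod
      (Pi.evalAlgHom ℚ T 4)))))
    ⟨fun f g h => ?_, fun x => ?_⟩⟩
  · simp only [AlgHom.prod_apply, Pi.evalAlgHom_apply, Prod.mk.injEq] at h
    funext i
    match i with
    | ⟨0, _⟩ => exact h.1
    | ⟨1, _⟩ => exact h.2.1
    | ⟨2, _⟩ => exact h.2.2.1
    | ⟨3, _⟩ => exact h.2.2.2.1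
    | ⟨4, _⟩ => exact h.2.2.2.2
  · exact ⟨Fin.cons x.1 (Fin.cons x.2.1 (Fin.cons x.2.2.1 (Fin.cons x.2.2.2.1 (Fin.cons x.2.2.2.2 finZeroElim)))), rfl⟩

/-- **GGL THM. 3.0 + LEMMA 14 at `m = 40`:
`End⁰(J_{40}) ≃ₐ[ℚ] ℚ(ζ_4) × (Mat₂(ℚ(ζ_8 − ζ_8⁻¹)) × (Mat₂(ℚ(ζ_5)) × (Mat₄(ℚ(r₂₀)) × Mat₂(ℚ(ζ_{40} − ζ_{40}⁻¹)))))`**, `r₂₀ = ζ + ζ³ + ζ⁷ + ζ⁹`, `r₂₀² = −5`,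
on the carrier `⨁_{Fin 5} ![A₄, A₈, A₅ ⊕ A₁₀, A₂₀, A₄₀]`: the blocks are pairwise orthogonal (§2), `End⁰` of an orthogonal biproduct is the product
(Mumford §19 Cor. 2), and the blocks have `End⁰ = ℚ(ζ_4)`, `Mat₂(ℚ(ζ_8 − ζ_8⁻¹))` (Lemma 14 (2)), `Mat₂(ℚ(ζ_5))` (F20), `Mat₄(ℚ(r₂₀))` (Lemma 14 (3)),
`Mat₂(ℚ(ζ_{40} − ζ_{40}⁻¹))` (Lemma 14 (2)).
[cite: GalleseGoodsonLombardo2024, §3.5 Lemma 14 and the sentence following it; §3 Thm. 3.0 (4)–(6), last statement; §3.4]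
[cite: MumfordAV1970, §19 Cor. 2 of Thm. 3 and p. 174] [cite: Shimura1998, §5.1 Prop. 3 (proof) and Prop. 6] -/
theorem nonempty_endAlgebra_algEquiv_fortyJacobian (hA₄ : IsCMTypeRealisation Φ₄ A₄ ι₄ θ₄)
    (hΦ₈ : ∀ σ : K₈ →+* ℂ, σ ∈ Φ₈.1 ↔ 2 * (expOf 8 K₈ σ).val < 8) (hA₈ : IsCMTypeRealisation Φ₈ A₈ ι₈ θ₈)
    (hΦ₅ : ∀ σ : K₅ →+* ℂ, σ ∈ Φ₅.1 ↔ 2 * (expOf 5 K₅ σ).val < 5) (hA₅ : IsCMTypeRealisation Φ₅ A₅ ι₅ θ₅)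
    (hΨ₅ : ∀ σ : L₅ →+* ℂ, σ ∈ Ψ₅.1 ↔ 2 * (expOf (2 * 5) L₅ σ).val < 2 * 5) (hA₁₀ : IsCMTypeRealisation Ψ₅ A₁₀ ι₁₀ θ₁₀)
    (hΦ₂₀ : ∀ σ : K₂₀ →+* ℂ, σ ∈ Φ₂₀.1 ↔ 2 * (expOf 20 K₂₀ σ).val < 20) (hA₂₀ : IsCMTypeRealisation Φ₂₀ A₂₀ ι₂₀ θ₂₀)
    (hΦ₄₀ : ∀ σ : K₄₀ →+* ℂ, σ ∈ Φ₄₀.1 ↔ 2 * (expOf 40 K₄₀ σ).val < 40) (hA₄₀ : IsCMTypeRealisation Φ₄₀ A₄₀ ι₄₀ θ₄₀) :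
    Nonempty ((⨁ fun i : Fin 5 =>
        (![A₄, A₈, ⨁ fun l : Fin 2 => (![A₅, A₁₀] : Fin 2 → AbelianVariety ℂ) l, A₂₀, A₄₀] : Fin 5 → AbelianVariety ℂ) i).endAlgebra ≃ₐ[ℚ]
      K₄ × (Matrix (Fin 2) (Fin 2) (IntermediateField.adjoin ℚ {zetaOf 8 K₈ - (zetaOf 8 K₈)⁻¹}) × (Matrix (Fin 2) (Fin 2) K₅ ×
        (Matrix (Fin 4) (Fin 4) (IntermediateField.adjoin ℚ {zetaOf 20 K₂₀ + zetaOf 20 K₂₀ ^ 3 + zetaOf 20 K₂₀ ^ 7 + zetaOf 20 K₂₀ ^ 9}) ×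
          Matrix (Fin 2) (Fin 2) (IntermediateField.adjoin ℚ {zetaOf 40 K₄₀ - (zetaOf 40 K₄₀)⁻¹}))))) := by
  classical
  haveI : NeZero (2 * 5 : ℕ) := ⟨by norm_num⟩
  have hodd5 : Odd 5 := by decide
  obtain ⟨E, -⟩ := AbelianVariety.nonempty_algEquiv_endAlgebra_biproduct_pi
    (A := fun i : Fin 5 => (![A₄, A₈, ⨁ fun l : Fin 2 => (![A₅, A₁₀] : Fin 2 → AbelianVariety ℂ) l, A₂₀, A₄₀] : Fin 5 → AbelianVariety ℂ) i)
    (hom_eq_zero_blocks_forty hA₄ hΦ₈ hA₈ hΦ₅ hA₅ hΨ₅ hA₁₀ hΦ₂₀ hA₂₀ hΦ₄₀ hA₄₀)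
  obtain ⟨P⟩ := nonempty_pi_fin_five_algEquiv_prod'
    (fun i : Fin 5 => ((![A₄, A₈, ⨁ fun l : Fin 2 => (![A₅, A₁₀] : Fin 2 → AbelianVariety ℂ) l, A₂₀, A₄₀] : Fin 5 → AbelianVariety ℂ) i).endAlgebra)
  obtain ⟨e₀⟩ : Nonempty (A₄.endAlgebra ≃ₐ[ℚ] K₄) :=
    hA₄.nonempty_endAlgebra_algEquiv_of_primitive (CMTypeLattice.primitive_of_finrank_eq_two Φ₄ finrank_eq_two_four_f)
  obtain ⟨-, ⟨e₁⟩, -⟩ := nonempty_matrix_two_algEquiv_endAlgebra_of_four_dvd ⟨2, rfl⟩ le_rfl (by norm_num) (by norm_num) (by norm_num)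
    Φ₈ hΦ₈ hA₈
  obtain ⟨e₂⟩ := nonempty_endAlgebra_odd_twiceOdd_algEquiv_matrix hodd5 (by norm_num) hΦ₅ hA₅ hΨ₅ hA₁₀
  obtain ⟨-, -, -, ⟨e₃⟩, -⟩ := nonempty_matrix_four_algEquiv_endAlgebra_twenty Φ₂₀ hΦ₂₀ hA₂₀
  obtain ⟨-, ⟨e₄⟩, -⟩ := nonempty_matrix_two_algEquiv_endAlgebra_of_four_dvd ⟨10, rfl⟩ (by norm_num) (by norm_num) (by norm_num)
    (by norm_num) Φ₄₀ hΦ₄₀ hA₄₀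
  exact ⟨(E.trans P).trans (AlgEquiv.prodCongr e₀ (AlgEquiv.prodCongr e₁.symm (AlgEquiv.prodCongr e₂ (AlgEquiv.prodCongr e₃.symm e₄.symm))))⟩

/-- **`dim_ℚ End⁰(J_{40}) = 90` and `dim J_{40} = 19 = g(C_{40})`** (`2 + 8 + 16 + 32 + 32`; `1 + 2 + 4 + 4 + 8`).
[cite: GalleseGoodsonLombardo2024, §3 Thm. 3.0 and §3.5 Lemma 14] [cite: MumfordAV1970, §19 Cor. 2 of Thm. 3] -/
theorem finrank_endAlgebra_fortyJacobian (hA₄ : IsCMTypeRealisation Φ₄ A₄ ι₄ θ₄)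
    (hΦ₈ : ∀ σ : K₈ →+* ℂ, σ ∈ Φ₈.1 ↔ 2 * (expOf 8 K₈ σ).val < 8) (hA₈ : IsCMTypeRealisation Φ₈ A₈ ι₈ θ₈)
    (hΦ₅ : ∀ σ : K₅ →+* ℂ, σ ∈ Φ₅.1 ↔ 2 * (expOf 5 K₅ σ).val < 5) (hA₅ : IsCMTypeRealisation Φ₅ A₅ ι₅ θ₅)
    (hΨ₅ : ∀ σ : L₅ →+* ℂ, σ ∈ Ψ₅.1 ↔ 2 * (expOf (2 * 5) L₅ σ).val < 2 * 5) (hA₁₀ : IsCMTypeRealisation Ψ₅ A₁₀ ι₁₀ θ₁₀)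
    (hΦ₂₀ : ∀ σ : K₂₀ →+* ℂ, σ ∈ Φ₂₀.1 ↔ 2 * (expOf 20 K₂₀ σ).val < 20) (hA₂₀ : IsCMTypeRealisation Φ₂₀ A₂₀ ι₂₀ θ₂₀)
    (hΦ₄₀ : ∀ σ : K₄₀ →+* ℂ, σ ∈ Φ₄₀.1 ↔ 2 * (expOf 40 K₄₀ σ).val < 40) (hA₄₀ : IsCMTypeRealisation Φ₄₀ A₄₀ ι₄₀ θ₄₀) :
    finrank ℚ (⨁ fun i : Fin 5 =>
        (![A₄, A₈, ⨁ fun l : Fin 2 => (![A₅, A₁₀] : Fin 2 → AbelianVariety ℂ) l, A₂₀, A₄₀] : Fin 5 → AbelianVariety ℂ) i).endAlgebra = 90 ∧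
    (⨁ fun i : Fin 5 =>
        (![A₄, A₈, ⨁ fun l : Fin 2 => (![A₅, A₁₀] : Fin 2 → AbelianVariety ℂ) l, A₂₀, A₄₀] : Fin 5 → AbelianVariety ℂ) i).dim = 19 := by
  classical
  haveI : NeZero (2 * 5 : ℕ) := ⟨by norm_num⟩
  have hodd5 : Odd 5 := by decide
  have h4 : 4 ∣ 40 := ⟨10, rfl⟩
  obtain ⟨hd₂₀, -, hF₂₀, -⟩ := nonempty_matrix_four_algEquiv_endAlgebra_twenty Φ₂₀ hΦ₂₀ hA₂₀
  have hK₅ : finrank ℚ K₅ = 4 := by rw [finrank_eq_totient 5 K₅]; decide +kernel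
  have hK₈ : finrank ℚ K₈ = 4 := by rw [finrank_eq_totient 8 K₈]; decide +kernel
  have hK₄₀ : finrank ℚ K₄₀ = 16 := by rw [finrank_eq_totient 40 K₄₀]; decide +kernel
  have hF₈ : finrank ℚ (IntermediateField.adjoin ℚ {zetaOf 8 K₈ - (zetaOf 8 K₈)⁻¹}) = 2 := by
    obtain ⟨K₁, Φ₁, h₁, hp₁, -⟩ :=
      exists_primitive_inducedCMType_index_two_of_four_dvd ⟨2, rfl⟩ le_rfl (by norm_num) (by norm_num) (by norm_num) Φ₈ hΦ₈
    obtain ⟨-, -, -, -, -, -, -, hdeg, hK₁⟩ :=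
      eq_fixedField_and_eq_adjoin_of_primitive_of_four_dvd ⟨2, rfl⟩ le_rfl (by norm_num) (by norm_num) (by norm_num) Φ₈ hΦ₈ Φ₁ h₁ hp₁
    rw [← hK₁]
    rw [show Nat.totient 8 = 4 by decide +kernel] at hdeg
    omega
  have hF₄₀ : finrank ℚ (IntermediateField.adjoin ℚ {zetaOf 40 K₄₀ - (zetaOf 40 K₄₀)⁻¹}) = 8 := by
    obtain ⟨K₁, Φ₁, h₁, hp₁, -⟩ :=
      exists_primitive_inducedCMType_index_two_of_four_dvd h4 (by norm_num) (by norm_num) (by norm_num) (by norm_num) Φ₄₀ hΦ₄₀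
    obtain ⟨-, -, -, -, -, -, -, hdeg, hK₁⟩ :=
      eq_fixedField_and_eq_adjoin_of_primitive_of_four_dvd h4 (by norm_num) (by norm_num) (by norm_num) (by norm_num) Φ₄₀ hΦ₄₀ Φ₁ h₁ hp₁
    rw [← hK₁]
    rw [show Nat.totient 40 = 16 by decide +kernel] at hdeg
    omega
  refine ⟨?_, ?_⟩
  · obtain ⟨e⟩ := nonempty_endAlgebra_algEquiv_fortyJacobian hA₄ hΦ₈ hA₈ hΦ₅ hA₅ hΨ₅ hA₁₀ hΦ₂₀ hA₂₀ hΦ₄₀ hA₄₀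
    haveI : FiniteDimensional ℚ (IntermediateField.adjoin ℚ {zetaOf 8 K₈ - (zetaOf 8 K₈)⁻¹}) := IntermediateField.finiteDimensional_left _
    haveI : FiniteDimensional ℚ (IntermediateField.adjoin ℚ {zetaOf 20 K₂₀ + zetaOf 20 K₂₀ ^ 3 + zetaOf 20 K₂₀ ^ 7 + zetaOf 20 K₂₀ ^ 9}) :=
      IntermediateField.finiteDimensional_left _
    haveI : FiniteDimensional ℚ (IntermediateField.adjoin ℚ {zetaOf 40 K₄₀ - (zetaOf 40 K₄₀)⁻¹}) := IntermediateField.finiteDimensional_left _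
    -- finiteness and freeness of the factors and of the nested products, bottom-up
    haveI : Module.Finite ℚ (Matrix (Fin 2) (Fin 2) (IntermediateField.adjoin ℚ {zetaOf 40 K₄₀ - (zetaOf 40 K₄₀)⁻¹})) := Module.Finite.matrix
    haveI : Module.Finite ℚ (Matrix (Fin 4) (Fin 4)
        (IntermediateField.adjoin ℚ {zetaOf 20 K₂₀ + zetaOf 20 K₂₀ ^ 3 + zetaOf 20 K₂₀ ^ 7 + zetaOf 20 K₂₀ ^ 9})) := Module.Finite.matrix
    haveI : Module.Finite ℚ (Matrix (Fin 2) (Fin 2) K₅) := Module.Finite.matrix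
    haveI : Module.Finite ℚ (Matrix (Fin 2) (Fin 2) (IntermediateField.adjoin ℚ {zetaOf 8 K₈ - (zetaOf 8 K₈)⁻¹})) := Module.Finite.matrix
    haveI : Module.Free ℚ (Matrix (Fin 2) (Fin 2) (IntermediateField.adjoin ℚ {zetaOf 40 K₄₀ - (zetaOf 40 K₄₀)⁻¹})) := inferInstance
    haveI : Module.Free ℚ (Matrix (Fin 4) (Fin 4)
        (IntermediateField.adjoin ℚ {zetaOf 20 K₂₀ + zetaOf 20 K₂₀ ^ 3 + zetaOf 20 K₂₀ ^ 7 + zetaOf 20 K₂₀ ^ 9})) := inferInstance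
    haveI : Module.Free ℚ (Matrix (Fin 2) (Fin 2) K₅) := inferInstance
    haveI : Module.Free ℚ (Matrix (Fin 2) (Fin 2) (IntermediateField.adjoin ℚ {zetaOf 8 K₈ - (zetaOf 8 K₈)⁻¹})) := inferInstance
    haveI : Module.Finite ℚ (Matrix (Fin 4) (Fin 4)
        (IntermediateField.adjoin ℚ {zetaOf 20 K₂₀ + zetaOf 20 K₂₀ ^ 3 + zetaOf 20 K₂₀ ^ 7 + zetaOf 20 K₂₀ ^ 9}) ×
        Matrix (Fin 2) (Fin 2) (IntermediateField.adjoin ℚ {zetaOf 40 K₄₀ - (zetaOf 40 K₄₀)⁻¹})) := inferInstance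
    haveI : Module.Free ℚ (Matrix (Fin 4) (Fin 4)
        (IntermediateField.adjoin ℚ {zetaOf 20 K₂₀ + zetaOf 20 K₂₀ ^ 3 + zetaOf 20 K₂₀ ^ 7 + zetaOf 20 K₂₀ ^ 9}) ×
        Matrix (Fin 2) (Fin 2) (IntermediateField.adjoin ℚ {zetaOf 40 K₄₀ - (zetaOf 40 K₄₀)⁻¹})) := inferInstance
    haveI : Module.Finite ℚ (Matrix (Fin 2) (Fin 2) K₅ × (Matrix (Fin 4) (Fin 4)
        (IntermediateField.adjoin ℚ {zetaOf 20 K₂₀ + zetaOf 20 K₂₀ ^ 3 + zetaOf 20 K₂₀ ^ 7 + zetaOf 20 K₂₀ ^ 9}) ×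
        Matrix (Fin 2) (Fin 2) (IntermediateField.adjoin ℚ {zetaOf 40 K₄₀ - (zetaOf 40 K₄₀)⁻¹}))) := inferInstance
    haveI : Module.Free ℚ (Matrix (Fin 2) (Fin 2) K₅ × (Matrix (Fin 4) (Fin 4)
        (IntermediateField.adjoin ℚ {zetaOf 20 K₂₀ + zetaOf 20 K₂₀ ^ 3 + zetaOf 20 K₂₀ ^ 7 + zetaOf 20 K₂₀ ^ 9}) ×
        Matrix (Fin 2) (Fin 2) (IntermediateField.adjoin ℚ {zetaOf 40 K₄₀ - (zetaOf 40 K₄₀)⁻¹}))) := inferInstance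
    haveI : Module.Finite ℚ (Matrix (Fin 2) (Fin 2) (IntermediateField.adjoin ℚ {zetaOf 8 K₈ - (zetaOf 8 K₈)⁻¹}) ×
        (Matrix (Fin 2) (Fin 2) K₅ × (Matrix (Fin 4) (Fin 4)
          (IntermediateField.adjoin ℚ {zetaOf 20 K₂₀ + zetaOf 20 K₂₀ ^ 3 + zetaOf 20 K₂₀ ^ 7 + zetaOf 20 K₂₀ ^ 9}) ×
          Matrix (Fin 2) (Fin 2) (IntermediateField.adjoin ℚ {zetaOf 40 K₄₀ - (zetaOf 40 K₄₀)⁻¹})))) := inferInstance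
    haveI : Module.Free ℚ (Matrix (Fin 2) (Fin 2) (IntermediateField.adjoin ℚ {zetaOf 8 K₈ - (zetaOf 8 K₈)⁻¹}) ×
        (Matrix (Fin 2) (Fin 2) K₅ × (Matrix (Fin 4) (Fin 4)
          (IntermediateField.adjoin ℚ {zetaOf 20 K₂₀ + zetaOf 20 K₂₀ ^ 3 + zetaOf 20 K₂₀ ^ 7 + zetaOf 20 K₂₀ ^ 9}) ×
          Matrix (Fin 2) (Fin 2) (IntermediateField.adjoin ℚ {zetaOf 40 K₄₀ - (zetaOf 40 K₄₀)⁻¹})))) := inferInstance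
    rw [e.toLinearEquiv.finrank_eq, Module.finrank_prod, Module.finrank_prod, Module.finrank_prod, Module.finrank_prod,
      Module.finrank_matrix, Module.finrank_matrix, Module.finrank_matrix, Module.finrank_matrix]
    simp only [Fintype.card_fin]
    rw [finrank_eq_two_four_f (K₄ := K₄), hF₈, hK₅, hF₂₀, hF₄₀]
  · have hd₄ : A₄.dim = 1 := by
      have h : A₄.dim = finrank ℚ K₄ / 2 := Motives.schemeDim_eq_holds hA₄.1
      rw [finrank_eq_two_four_f (K₄ := K₄)] at h
      simpa using h
    have hd₈ : A₈.dim = 2 := by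
      have h : A₈.dim = finrank ℚ K₈ / 2 := Motives.schemeDim_eq_holds hA₈.1
      rw [hK₈] at h
      simpa using h
    have hd := dim_pair_odd_twiceOdd hodd5 (by norm_num) hΦ₅ hA₅ hΨ₅ hA₁₀
    rw [show Nat.totient 5 = 4 by decide +kernel] at hd
    have hd₄₀ : A₄₀.dim = 8 := by
      have h : A₄₀.dim = finrank ℚ K₄₀ / 2 := Motives.schemeDim_eq_holds hA₄₀.1
      rw [hK₄₀] at h
      simpa using h
    rw [AbelianVariety.dim_biproduct, Fin.sum_univ_five]
    show A₄.dim + A₈.dim + (⨁ fun l : Fin 2 => (![A₅, A₁₀] : Fin 2 → AbelianVariety ℂ) l).dim + A₂₀.dim + A₄₀.dim = 19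
    omega

end Forty

end HyperellipticJacobian

end Literature.AlgebraicGeometry.ComplexMultiplication

end
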